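import Mathlib.LinearAlgebra.Vandermonde
import Summits.Ventures.HSemireg.WedgeHankelModel

/-!
# Venture HSemireg — THE HANKEL RANK OF AN `r`-SECANT CLASS: `rank H_k(Σ_{i<r} A_i λ_i^•) = r` for `r ≤ min(k+1, m+1−k)`

HONEST FRAMING. Part of the Lean index of the computation cell `pub-hsemireg` (seat p10 gen 14, Sunday typer «UNIFORM-IN-n»).
LINEAR ALGEBRA OF HANKEL (catalecticant) MATRICES over a field ONLY: no variety, no cohomology theory, no sheaf, no Ext group and no
semiregularity map is constructed here; nothing here says that HC / HC_CM / HC_AV holds; no Literature fact is declared or used.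
Custodian versions cited: theory/FORMULA-N.md PART A §2.6 THEOREM H and its KRONECKER DICTIONARY (ranks `ρ = 1` pure, `ρ = 2` the
three pairs, `ρ = k+1` generic); STRUCTURE.md v1.0-SIGNED 9b196a05977dd067 §1.1 C15.  The dictionary (`Σ_i A_i exp(λ_i Θ)` ↦ the
coefficient sequence `q_j = Σ_i A_i λ_i^j` ↦ th-7's Hankel class `w_m(q)`) is QUOTED, never asserted.

WHAT IS IN THE TREE.  th-7's THEOREM H (`Wedge.Hankel.hankelLaw_model`): `rank(θ ↦ θ ∧ w_m(q) ∣ ⋀^k) = C(m,k) · rank H_k(q)` with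
`H_k(q) = (q_{i+s})_{i ≤ k, s ≤ m−k}` (`Wedge.Hankel.hankel1`); the Hankel ranks of the PURE sequence `Aλ^j` (`1`, `WedgeHankelFaces`)
and of the TRANSVERSE PAIR `Aλ^j + Bμ^j` (`2`, `WedgeHankelBox.rank_hankel1_tpSeq`, read off THEOREM T).  THIS FILE computes the Hankel
rank of the general `r`-SECANT sequence by linear algebra (a Vandermonde minor; technique adapted from `ApolarGramHankel` (ℝ, square
Hankel matrices) to every field and th-7's rectangular `hankel1`):
* §1 `secSeq A λ : j ↦ Σ_{i<r} A_i λ_i^j`; the (weighted) NODE matrices `(A_i λ_i^l)_{i<r, l<c}`; **`hankel1_secSeq`: `H_k(q) = Bᵀ V`**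
  (`B` = weighted nodes on `k+1` columns, `V` = nodes on `m+1−k` columns) — so **`rank H_k(q) ≤ r` always** (`rank_hankel1_secSeq_le`).
* §2 the VANDERMONDE MINOR: for distinct nodes and non-zero weights, `Bᵀ` is injective and `B` is onto when `r ≤ c`
  (`transpose_mulVecLin_injective`, `range_mulVecLin_eq_top`), and `B` is injective when `c ≤ r` (`mulVecLin_injective`).
* §3 **`rank_hankel1_secSeq`: `rank H_k(Σ_{i<r} A_i λ_i^•) = r` whenever `r ≤ k + 1` and `r ≤ m + 1 − k`** (distinct `λ_i`, all
  `A_i ≠ 0`, every field); `= k + 1` for `k + 1 ≤ r ≤ m + 1 − k` (`rank_hankel1_secSeq_of_le`), i.e. **THE SECANT RANK LAW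
  `rank H_k = min(r, k+1)` for `r ≤ m + 1 − k`** (`rank_hankel1_secSeq_eq_min`); with THEOREM H: **`rank(θ ↦ θ ∧ w_m(q) ∣ ⋀^k) = r · C(m,k)`** (`finrank_range_wedge_w_secSeq`) and the kernel
  NUMBER **`dim ker + r · C(m,k) = C(2m,k)`** (`finrank_ker_wedge_w_secSeq_add`) — the NAME of that kernel (the intersection of the `r`
  frame ideals) is the next leaf.
Namespace `Summit.Ventures.HSemireg.Wedge.HankelSecant` (new); new names only.
-/

open Module
open scoped Matrix

namespace Summit.Ventures.HSemireg.Wedge.HankelSecant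

open Summit.Ventures.HSemireg.Wedge Summit.Ventures.HSemireg.Wedge.Hankel

variable (K : Type*) [Field K]

/-! ## §1. Secant sequences and node matrices -/

/-- the `r`-SECANT coefficient sequence `q_j = Σ_{i<r} A_i λ_i^j` (quoted: the class `Σ_i A_i exp(λ_i Θ)`). -/
def secSeq {r : ℕ} (A lam : Fin r → K) : ℕ → K := fun j => ∑ i, A i * lam i ^ j

variable {K}

/-- the WEIGHTED NODE MATRIX `B_{i,l} = A_i λ_i^l` (`r` rows, `c` columns). -/
def wNodeMat {r : ℕ} (A lam : Fin r → K) (c : ℕ) : Matrix (Fin r) (Fin c) K :=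
  Matrix.of fun i l => A i * lam i ^ (l : ℕ)

/-- entries of the weighted node matrix. -/
lemma wNodeMat_apply {r : ℕ} (A lam : Fin r → K) (c : ℕ) (i : Fin r) (l : Fin c) :
    wNodeMat A lam c i l = A i * lam i ^ (l : ℕ) := rfl

/-- secant sequences add over disjoint node sets: appending one node. -/
lemma secSeq_snoc {r : ℕ} (A lam : Fin r → K) (a l : K) :
    secSeq K (Fin.snoc A a) (Fin.snoc lam l) = secSeq K A lam + fun j => a * l ^ j := by
  funext j
  simp only [secSeq, Pi.add_apply, Fin.sum_univ_castSucc, Fin.snoc_castSucc, Fin.snoc_last]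

/-- no node: the zero sequence. -/
lemma secSeq_zero (A lam : Fin 0 → K) : secSeq K A lam = 0 := by
  funext j; simp [secSeq]

/-- one node: the pure sequence `A λ^j`. -/
lemma secSeq_one (A lam : Fin 1 → K) : secSeq K A lam = fun j => A 0 * lam 0 ^ j := by
  funext j; simp [secSeq]

/-- **`H_k(q) = Bᵀ V`** for a secant sequence: `(q_{i+s}) = Σ_j (A_j λ_j^i) · λ_j^s`. -/
theorem hankel1_secSeq (n k : ℕ) {r : ℕ} (A lam : Fin r → K) :
    hankel1 K n k (secSeq K A lam) = (wNodeMat A lam (k + 1))ᵀ * wNodeMat (fun _ => (1 : K)) lam (n + 1 - k) := by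
  ext i s
  simp only [hankel1, secSeq, wNodeMat, Matrix.mul_apply, Matrix.transpose_apply, Matrix.of_apply, pow_add, one_mul,
    mul_assoc]

/-- hence **`rank H_k(Σ_{i<r} A_i λ_i^•) ≤ r`** for every `k`, every nodes and weights. -/
theorem rank_hankel1_secSeq_le (n k : ℕ) {r : ℕ} (A lam : Fin r → K) :
    (hankel1 K n k (secSeq K A lam)).rank ≤ r := by
  rw [hankel1_secSeq]
  exact (Matrix.rank_mul_le_left _ _).trans ((Matrix.rank_le_width _).trans le_rfl)

/-! ## §2. The Vandermonde minor -/

/-- `Bᵀ` has trivial kernel when `r ≤ c`, the weights are non-zero and the nodes distinct (a Vandermonde minor).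
-- adapted from `ApolarGramHankel.wNodeMat_transpose_mulVec_injective` (ℝ) to every field. -/
theorem transpose_mulVecLin_injective {r c : ℕ} (hrc : r ≤ c) {A lam : Fin r → K} (hA : ∀ i, A i ≠ 0)
    (hlam : Function.Injective lam) : Function.Injective (wNodeMat A lam c)ᵀ.mulVecLin := by
  rw [← LinearMap.ker_eq_bot, LinearMap.ker_eq_bot']
  intro w hw
  have hw' : ∀ l : Fin c, ∑ i, w i * (A i * lam i ^ (l : ℕ)) = 0 := by
    intro l
    have := congrFun hw l
    simpa [Matrix.mulVecLin_apply, Matrix.mulVec_transpose, Matrix.vecMul, dotProduct, wNodeMat] using this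
  have hvec : Matrix.vecMul (fun i => A i * w i) (Matrix.vandermonde lam) = 0 := by
    funext j
    simp only [Matrix.vecMul, dotProduct, Matrix.vandermonde_apply, Pi.zero_apply]
    rw [← hw' ⟨j, by have := j.isLt; omega⟩]
    exact Finset.sum_congr rfl fun i _ => by ring
  have hdet : (Matrix.vandermonde lam).det ≠ 0 := Matrix.det_vandermonde_ne_zero_iff.2 hlam
  have h0 := Matrix.eq_zero_of_vecMul_eq_zero hdet hvec
  funext i
  have := congrFun h0 i
  simpa [hA i] using this

/-- `B` has rank `r` … -/
theorem rank_wNodeMat {r c : ℕ} (hrc : r ≤ c) {A lam : Fin r → K} (hA : ∀ i, A i ≠ 0) (hlam : Function.Injective lam) :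
    (wNodeMat A lam c).rank = r := by
  rw [← Matrix.rank_transpose, Matrix.rank, LinearMap.finrank_range_of_inj (transpose_mulVecLin_injective hrc hA hlam),
    finrank_fintype_fun_eq_card, Fintype.card_fin]

/-- … so `B` is onto `K^r`. -/
theorem range_mulVecLin_eq_top {r c : ℕ} (hrc : r ≤ c) {A lam : Fin r → K} (hA : ∀ i, A i ≠ 0)
    (hlam : Function.Injective lam) : LinearMap.range (wNodeMat A lam c).mulVecLin = ⊤ := by
  apply Submodule.eq_top_of_finrank_eq
  rw [← Matrix.rank, rank_wNodeMat hrc hA hlam, finrank_fintype_fun_eq_card, Fintype.card_fin]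

/-- with at least `c` distinct nodes (`c ≤ r`) and non-zero weights, `B` itself is injective (a Vandermonde minor on the first
`c` nodes). -/
theorem mulVecLin_injective {r c : ℕ} (hcr : c ≤ r) {A lam : Fin r → K} (hA : ∀ i, A i ≠ 0)
    (hlam : Function.Injective lam) : Function.Injective (wNodeMat A lam c).mulVecLin := by
  rw [← LinearMap.ker_eq_bot, LinearMap.ker_eq_bot']
  intro w hw
  have hw' : ∀ i : Fin r, ∑ l : Fin c, lam i ^ (l : ℕ) * w l = 0 := by
    intro i
    have h := congrFun hw i
    simp only [Matrix.mulVecLin_apply, Matrix.mulVec, dotProduct, wNodeMat, Matrix.of_apply, Pi.zero_apply, mul_assoc,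
      ← Finset.mul_sum, mul_eq_zero, hA i, false_or] at h
    exact h
  have hvec : Matrix.mulVec (Matrix.vandermonde (lam ∘ Fin.castLE hcr)) w = 0 := by
    funext i
    simp only [Matrix.mulVec, dotProduct, Matrix.vandermonde_apply, Function.comp_apply, Pi.zero_apply]
    exact hw' _
  have hdet : (Matrix.vandermonde (lam ∘ Fin.castLE hcr)).det ≠ 0 :=
    Matrix.det_vandermonde_ne_zero_iff.2 (hlam.comp (Fin.castLE_injective hcr))
  exact Matrix.eq_zero_of_mulVec_eq_zero hdet hvec

/-- … so `B` has rank `c` in that regime. -/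
theorem rank_wNodeMat_of_le {r c : ℕ} (hcr : c ≤ r) {A lam : Fin r → K} (hA : ∀ i, A i ≠ 0) (hlam : Function.Injective lam) :
    (wNodeMat A lam c).rank = c := by
  rw [Matrix.rank, LinearMap.finrank_range_of_inj (mulVecLin_injective hcr hA hlam), finrank_fintype_fun_eq_card,
    Fintype.card_fin]

/-! ## §3. The Hankel rank of a secant class -/

/-- **THE HANKEL RANK OF AN `r`-SECANT SEQUENCE: `rank H_k(Σ_{i<r} A_i λ_i^•) = r` for `r ≤ k + 1` and `r ≤ m + 1 − k`**
(distinct nodes `λ_i`, non-zero weights `A_i`; every field, `m`, `k`).  `r = 1` is the pure face (`WedgeHankelFaces.rank_hankel1_expSeq`),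
`r = 2` the transverse pair (`WedgeHankelBox.rank_hankel1_tpSeq`), `r = k + 1` the generic rank of gen 11's full-rank criterion. -/
theorem rank_hankel1_secSeq {m k r : ℕ} (hrk : r ≤ k + 1) (hrm : r ≤ m + 1 - k) {A lam : Fin r → K} (hA : ∀ i, A i ≠ 0)
    (hlam : Function.Injective lam) : (hankel1 K m k (secSeq K A lam)).rank = r := by
  rw [hankel1_secSeq, Matrix.rank, Matrix.mulVecLin_mul,
    LinearMap.range_comp_of_range_eq_top _ (range_mulVecLin_eq_top hrm (fun _ => one_ne_zero) hlam),
    LinearMap.finrank_range_of_inj (transpose_mulVecLin_injective hrk hA hlam), finrank_fintype_fun_eq_card, Fintype.card_fin]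

/-- MORE NODES THAN ROWS: **`rank H_k(Σ_{i<r} A_i λ_i^•) = k + 1` (full row rank) for `k + 1 ≤ r ≤ m + 1 − k`** — whatever the
(non-zero) weights: gen 11's full-rank criterion then names the kernel (the Siegel ideal `SI_k`). -/
theorem rank_hankel1_secSeq_of_le {m k r : ℕ} (hkr : k + 1 ≤ r) (hrm : r ≤ m + 1 - k) {A lam : Fin r → K}
    (hA : ∀ i, A i ≠ 0) (hlam : Function.Injective lam) : (hankel1 K m k (secSeq K A lam)).rank = k + 1 := by
  rw [hankel1_secSeq, Matrix.rank, Matrix.mulVecLin_mul,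
    LinearMap.range_comp_of_range_eq_top _ (range_mulVecLin_eq_top hrm (fun _ => one_ne_zero) hlam), ← Matrix.rank,
    Matrix.rank_transpose, rank_wNodeMat_of_le hkr hA hlam]

/-- together, **THE SECANT RANK LAW: `rank H_k(Σ_{i<r} A_i λ_i^•) = min(r, k + 1)` whenever `r ≤ m + 1 − k`** (distinct nodes,
non-zero weights, every field). -/
theorem rank_hankel1_secSeq_eq_min {m k r : ℕ} (hrm : r ≤ m + 1 - k) {A lam : Fin r → K} (hA : ∀ i, A i ≠ 0)
    (hlam : Function.Injective lam) : (hankel1 K m k (secSeq K A lam)).rank = min r (k + 1) := by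
  rcases le_total r (k + 1) with h | h
  · rw [min_eq_left h]; exact rank_hankel1_secSeq h hrm hA hlam
  · rw [min_eq_right h]; exact rank_hankel1_secSeq_of_le h hrm hA hlam

/-- with th-7's THEOREM H: **`rank(θ ↦ θ ∧ w_m(Σ_{i<r} A_i λ_i^•) ∣ ⋀^k K^{2m}) = C(m,k) · r`** in the same range. -/
theorem finrank_range_wedge_w_secSeq {m k r : ℕ} (hrk : r ≤ k + 1) (hrm : r ≤ m + 1 - k) {A lam : Fin r → K}
    (hA : ∀ i, A i ≠ 0) (hlam : Function.Injective lam) :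
    finrank K (LinearMap.range (wedge K m k (w K m m (secSeq K A lam)))) = m.choose k * r := by
  rw [hankelLaw_model, rank_hankel1_secSeq hrk hrm hA hlam]

/-- `dim ⋀^k K^{2m} = C(2m, k)` (private copy; the public statement lands with gen 10's `WedgeHankelSpikes`). -/
private lemma finrank_exteriorPower' (m k : ℕ) : finrank K (⋀[K]^k (In m → K)) = (m + m).choose k := by
  rw [exteriorPower.finrank_eq, finrank_fintype_fun_eq_card, Fintype.card_fin]

/-- the kernel NUMBER of an `r`-secant class: **`dim ker(θ ↦ θ ∧ w_m(q) ∣ ⋀^k) + r · C(m,k) = C(2m,k)`** (`r ≤ k+1`, `r ≤ m+1−k`). -/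
theorem finrank_ker_wedge_w_secSeq_add {m k r : ℕ} (hrk : r ≤ k + 1) (hrm : r ≤ m + 1 - k) {A lam : Fin r → K}
    (hA : ∀ i, A i ≠ 0) (hlam : Function.Injective lam) :
    finrank K (LinearMap.ker (wedge K m k (w K m m (secSeq K A lam)))) + r * m.choose k = (m + m).choose k := by
  have h := LinearMap.finrank_range_add_finrank_ker (wedge K m k (w K m m (secSeq K A lam)))
  rw [finrank_range_wedge_w_secSeq hrk hrm hA hlam, finrank_exteriorPower'] at h
  rw [← h]; ring

/-- in every degree (no size hypothesis) the rank is AT MOST `C(m,k) · r` … -/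
theorem finrank_range_wedge_w_secSeq_le (m k : ℕ) {r : ℕ} (A lam : Fin r → K) :
    finrank K (LinearMap.range (wedge K m k (w K m m (secSeq K A lam)))) ≤ m.choose k * r := by
  rw [hankelLaw_model]
  exact Nat.mul_le_mul_left _ (rank_hankel1_secSeq_le m k A lam)

/-- … and the kernel number is AT LEAST `C(2m,k) − r · C(m,k)`. -/
theorem finrank_ker_wedge_w_secSeq_ge (m k : ℕ) {r : ℕ} (A lam : Fin r → K) :
    (m + m).choose k ≤ finrank K (LinearMap.ker (wedge K m k (w K m m (secSeq K A lam)))) + r * m.choose k := by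
  have h := LinearMap.finrank_range_add_finrank_ker (wedge K m k (w K m m (secSeq K A lam)))
  rw [finrank_exteriorPower'] at h
  have h2 := finrank_range_wedge_w_secSeq_le m k A lam
  rw [← h]
  nlinarith [h2, Nat.mul_comm (m.choose k) r]

end Summit.Ventures.HSemireg.Wedge.HankelSecant
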